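import Summits.MatrixMultiplication.OmegaCensus.STPPVosperTilingLaw
import Summits.MatrixMultiplication.OmegaCensus.STPPDisjointPacking

/-!
# ω-census (abelian STPP census): an UNCONDITIONAL kill at `ℤ₅₉` by the Vosper tiling law — `{(3,3,3),(3,3,4)}` (kernel)

HONEST FRAMING (pub-omega census; verbatim): lottery ticket; floor = certified bounds/negative ranges.
Census STRUCTURE (seat pub-omega-stpp-1 gen 30, 2026-08-28), family (b2).  First application of `no_isSTPP_of_tight_tiling_prime`
(`STPPVosperTilingLaw.lean`): the pattern `{(3,3,3),(3,3,4)}` is a leaf of the `ℤ₅₉` residual front of record that the window-table laws leave open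
(HOME `pub-omega-stpp-1-g29/scan/KERNEL-KILLS-Z59.json`; its tight reading `(c,a,b)`, block `(4,3,3)`, has table survivors `j ∈ {4, 15, 29, 30, 44, 55}`).
Here: `29, 30 = ±2⁻¹` are word ratios (`a = 4`), and for `j ∈ {4, 15, 44, 55}` the exact-cover search finds that the other block `(3,3,3)` cannot even realise
its two difference sets inside the progressions `Y°` (9 terms, step `j`) and `Z°` (9 terms, step `1`) — `existsCover … = false`, four kernel computations
of about a second.  UNCONDITIONAL (Vosper only; no Hamidoune–Rødseth).  Nothing here is progress on `ω`.  Python mirror of the checker: HOME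
`pub-omega-stpp-1-g30/code/cover_mirror.py`; feasibility pilot `code/tiling_pilot.py` (all 58 ratios dead, scan/tiling_59.txt).

References: A. G. Vosper, J. London Math. Soc. 31 (1956); M. B. Nathanson, GTM 165, Thm 2.7; H. Cohn, R. Kleinberg, B. Szegedy, C. Umans, FOCS 2005
(arXiv:math/0511460), Def. 5.1.
-/

open Finset
open scoped Pointwise

namespace Summit.MatrixMultiplication.OmegaCensus.CubeNB

open Literature.Computability.AlgebraicComplexity
open Literature.Combinatorics.Additive
open Summit.MatrixMultiplication.OmegaCensus.STPPKneser

/-! ## Table and splits -/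

section Tables

/-- Tight-type table `(n, m, r) = (48, 12, 3)` at `59` with the survivor target `{0, 1, 58, 4, 15, 29, 30, 44, 55}`. [folklore] -/
theorem table59_48_12_3_surv : ∀ j < 59, ∀ t < 59, (∀ i < 12, (t + j * i) % 59 < 48) →
    (∀ k < 12, 3 ∣ (t + j * k) % 59 - #((range 12).filter fun i => (t + j * i) % 59 < (t + j * k) % 59)) →
    j ∈ ({0, 1, 58, 4, 15, 29, 30, 44, 55} : Finset ℕ) := by
  decide +kernel

/-- The exact-cover searches for the four non-word survivors `j ∈ {4, 15, 44, 55}` (other block `(3,3,3)`, `L = 9`, `z = 9`) all FAIL. [folklore] -/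
theorem cover59_333_fail : ∀ jv ∈ ({4, 15, 44, 55} : Finset ℕ),
    existsCover 59 9 ((List.range 9).map fun t => (jv * t) % 59) [(3, 3, 3)] [] [] = false := by
  decide +kernel

/-- The split of the survivor target: word ratios (`0`, `±1`, `±2⁻¹` for `a = 4`, `b = 3`) or a failed exact-cover search. [folklore] -/
theorem split59_333_433 : ∀ jv ∈ ({0, 1, 58, 4, 15, 29, 30, 44, 55} : Finset ℕ),
    (jv = 0 ∨ (∃ k ∈ range 3, 1 ≤ k ∧ (jv = k ∨ jv + k = 59)) ∨ (∃ k ∈ range 4, 1 ≤ k ∧ (jv * k % 59 = 1 ∨ jv * k % 59 = 59 - 1))) ∨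
      existsCover 59 9 ((List.range 9).map fun t => (jv * t) % 59) [(3, 3, 3)] [] [] = false := by
  intro jv hjv
  have hcases : jv ∈ ({0, 1, 58, 29, 30} : Finset ℕ) ∨ jv ∈ ({4, 15, 44, 55} : Finset ℕ) := by
    revert hjv; revert jv; decide
  rcases hcases with h | h
  · left; revert h; revert jv; decide
  · right; exact cover59_333_fail jv h

end Tables

/-! ## The kill -/

section Kills

/-- **`{(3,3,3),(3,3,4)}` has no STPP family in `ℤ/59ℤ`** — UNCONDITIONAL (Vosper tiling law in the reading `(c,a,b)`, i.e. for the STPP family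
`(C, A, B)`, tight block `(4,3,3)`: `(z, b, vol, a, L) = (9, 3, 36, 4, 9)`, table `(48,12,3)`, word ratios `±1, ±2⁻¹`, exact covers for `j ∈ {4,15,44,55}` fail).
[cite: CohnKleinbergSzegedyUmans2005, Def. 5.1] [cite: Vosper1956, main theorem; Nathanson1996, Thm 2.7] -/
theorem no_isSTPP_zmod59_333_334 (A B C : Fin 2 → Finset (ZMod 59)) (hS : IsSTPP A B C)
    (hA : ∀ i, #(A i) = ![3, 3] i) (hB : ∀ i, #(B i) = ![3, 3] i) (hC : ∀ i, #(C i) = ![3, 4] i) : False := by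
  haveI : Fact (Nat.Prime 59) := ⟨by norm_num⟩
  have hS' : IsSTPP C A B := stpp_rotate (stpp_rotate hS)
  have hAne : ∀ i, (A i).Nonempty := fun i => card_pos.1 (by rw [hA]; fin_cases i <;> simp)
  have hBne : ∀ i, (B i).Nonempty := fun i => card_pos.1 (by rw [hB]; fin_cases i <;> simp)
  have hCne : ∀ i, (C i).Nonempty := fun i => card_pos.1 (by rw [hC]; fin_cases i <;> simp)
  have e1 : (univ : Finset (Fin 2)).erase 1 = {0} := by decide
  have hz : ∑ k ∈ (univ : Finset (Fin 2)).erase 1, #(C k) * #(B k) = 9 := by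
    rw [e1, Finset.sum_singleton]; simp [hB, hC]
  have hL : ∑ k ∈ (univ : Finset (Fin 2)).erase 1, #(A k) * #(B k) = 9 := by
    rw [e1, Finset.sum_singleton]; simp [hA, hB]
  have ha : #(C 1) = 4 := by rw [hC]; simp
  have hb : #(A 1) = 3 := by rw [hA]; simp
  have hvol : #(C 1) * #(A 1) * #(B 1) = 36 := by rw [hA, hB, hC]; simp
  refine no_isSTPP_of_tight_tiling_prime C A B hS' hCne hAne hBne 1 ⟨0, by decide⟩ ha hb hvol hz hL (by norm_num) (by norm_num)
    (by norm_num) (by norm_num) (by norm_num) (m := 12) (n := 48) rfl rfl [0] (by decide) (fun k => by fin_cases k <;> decide)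
    table59_48_12_3_surv (fun jv hjv => ?_)
  have hsz : ([0] : List (Fin 2)).map (fun k => (#(C k), #(A k), #(B k))) = [(3, 3, 3)] := by simp [hA, hB, hC]
  rw [hsz]
  exact split59_333_433 jv hjv

end Kills

end Summit.MatrixMultiplication.OmegaCensus.CubeNB
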